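import Literature.AlgebraicGeometry.Modules.SectionNormalisedTransition
import Literature.AlgebraicGeometry.Modules.LineBundleOfCocycleClass
import Literature.AlgebraicGeometry.Morphisms.NormalisedGeneratorCoface
import HarnessLib

/-!
# The rigidified rank-one functor is a Zariski sheaf on the base (effectivity)

Layer `Literature/AlgebraicGeometry/Modules`, namespace `Literature.AlgebraicGeometry.Modules`.
THEOREMS ONLY (no definition, no named fact, no instance).

[BoschLutkebohmertRaynaud1990, §8.1 Prop. 4] «the rigidified Picard functor `P_{X/B,e}` is a sheaf for the Zariski topology
when `π_*𝒪_X = 𝒪_B` universally»; [MumfordAV1970, §13, proof of the Theorem p. 125] «normalised isomorphisms are unique,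
hence the local Poincaré bundles glue»; [MumfordFogartyKirwan1994, Ch. 0 §5 (d), Ch. 6 §2 p. 121].  EFFECTIVITY HALF, in the
following form.  Data: `π : X ⟶ B` with a section `e`; open immersions `χᵢ : Bᵢ → B` into the base; CHART SPACES
`Ξᵢ : Xᵢ → X` (open immersions covering `X`) cartesian over the `χᵢ` with their sections `ecᵢ : Bᵢ → Xᵢ`; rank-one modules
`Lᵢ` on `Xᵢ` RIGIDIFIED along `ecᵢ` (`rᵢ : ecᵢ^*Lᵢ ≅ 𝒪`).  Hypotheses: STEIN — for every `b : T ⟶ B` the projection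
`X ×_B T → T` is surjective on global functions (e.g. `A ×_S T → T` for an abelian scheme, ★
`AbelianSchemes.AbelianSchemeSteinOfNoetherian.baseChange_appTop_bijective`); COMPATIBILITY (class level only!) — for every test
object `X ×_B T` and any two maps `mᵢ : X ×_B T → Xᵢ`, `mⱼ : X ×_B T → Xⱼ` over `X`, the modules `mᵢ^*Lᵢ` and `mⱼ^*Lⱼ` are
isomorphic.  Conclusion (`exists_hasRank_one_of_rigidified_baseCover`): a rank-one `P` on `X` with `Ξᵢ^*P ≅ Lᵢ` for every `i`.
(The INJECTIVITY half — «locally isomorphic rigidified families are isomorphic» — is ★ `AbelianSchemes/RigidifiedGluing`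
(`rigidifiedGluing_of_stein`) / ★ `RigidifiedTrivialOfOpenCover`.)

PROOF (Čech road, files 1–3a of the programme): on the test object `X_V := X ×_B V → V` of an open `V ⊆ X` (section
`e_V`, graph-section `s_V : V → X_V`) two charts `j, j'` whose images contain `V` are read through the cartesian lifts
`m : X_V → X_j`, `m' : X_V → X_{j'}`; their rigidifications transported to `X_V` (★ `Modules/SectionNormalisedIso` §4), THE
normalised isomorphism `Ψ : m^*L_j ≅ m'^*L_{j'}` exists uniquely (Stein), and the pair transition function of two frames
(★ `Modules/WedgeTransition`) read along `s_V` is the value `g_{xy}(V) ∈ Γ(X, V)` of a point-indexed Čech cocycle on `X`: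
multiplicativity is ★ `transitionDet_pair_mul`, compatibility with restriction and the coboundary to each chart's frame
cocycle are ★ `transitionDet_pair_baseChange` (functoriality of transport, ★ `transport_comp`) and ★ `transitionDet_pair_self`.
Then `P := lineBundle c` (★ `Modules/LineBundleOfCocycle`) and `Ξᵢ^*P ≅ Lᵢ` by ★ `nonempty_iso_iff_detClass_eq` ∘ ★ `detClass_pullback`
∘ ★ `detClass_lineBundle`, exactly as in ★ `Modules/RankOneZariskiGluing`.

Cell hodgecm-mathlib, FLOOR 0 P1, F-3 (Z), P-a: with `X := A ×_S Â⁰ → Â⁰`, the charts `Aᵢ ×_{Uᵢ} Âᵢ` (`prodChart`) and the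
chart Poincaré sheaves, the conclusion is the hypothesis block of `nonempty_dualPair_of_charts` (B-p06) — the consumer file
instantiates.  Everything is proved; no named facts.

## References
* [BoschLutkebohmertRaynaud1990] S. Bosch, W. Lütkebohmert, M. Raynaud, *Néron Models* (1990), §8.1 Prop. 4.
* [MumfordAV1970] D. Mumford, *Abelian Varieties* (1970), §13 (proof of the Thm. p. 125).
* [MumfordFogartyKirwan1994] D. Mumford, J. Fogarty, F. Kirwan, *GIT*, 3rd ed. (1994), Ch. 0 §5 (d), Ch. 6 §2 (p. 121).
* [StacksProject] The Stacks Project, Tag 04TP (glueing sheaves of modules).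
-/

noncomputable section

-- `Scheme.Modules` / `SheafOfModules` are not reducible (as in Mathlib's `AlgebraicGeometry/Modules/Sheaf.lean`).
set_option backward.isDefEq.respectTransparency false

open CategoryTheory CategoryTheory.Limits AlgebraicGeometry Opposite TopologicalSpace

universe v u

namespace Literature.AlgebraicGeometry.Modules

open Literature.AlgebraicGeometry.Motives

/-! ### Bookkeeping: `topIso`, images under open immersions, identifications `β^*𝒪 ≅ 𝒪` -/

/-- `topIso` followed by restriction to a smaller open is `(Z.homOfLE i)^♯` followed by `topIso`
(as morphisms `Γ(V, ⊤) ⟶ Γ(Z, V')`). [cite: StacksProject, Tag 04TP (glueing sheaves of modules)] -/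
private theorem topIso_hom_comp_map' {Z : Scheme.{u}} {V V' : Z.Opens} (i : V' ≤ V) :
    V.topIso.hom ≫ Z.presheaf.map (homOfLE i).op = (Z.homOfLE i).appLE ⊤ ⊤ le_top ≫ V'.topIso.hom := by
  rw [Scheme.homOfLE_appLE, Scheme.Opens.topIso_hom, Scheme.Opens.topIso_hom, ← Functor.map_comp,
    ← Functor.map_comp]
  rfl

/-- `topIso` followed by `θ^♯ : Γ(Z, V) → Γ(Z', W)` is `(θ|_W)^♯ : Γ(V, ⊤) → Γ(W, ⊤)` followed by `topIso`
(Mathlib `Scheme.Hom.resLE_appLE`). [cite: StacksProject, Tag 04TP (glueing sheaves of modules)] -/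
private theorem topIso_hom_comp_appLE' {Z Z' : Scheme.{u}} (θ : Z' ⟶ Z) {V : Z.Opens} {W : Z'.Opens} (hW : W ≤ θ ⁻¹ᵁ V) :
    V.topIso.hom ≫ θ.appLE V W hW = (θ.resLE V W hW).appLE ⊤ ⊤ le_top ≫ W.topIso.hom := by
  rw [Scheme.Hom.resLE_appLE, Scheme.Opens.topIso_hom, Scheme.Opens.topIso_hom, Scheme.Hom.map_appLE,
    Scheme.Hom.appLE_map]

/-- `V.ι^♯ : Γ(Y, U) → Γ(V, ⊤)` followed by `topIso` is the restriction `Γ(Y, U) → Γ(Y, V)` (`V ≤ U`).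
[cite: StacksProject, Tag 04TP (glueing sheaves of modules)] -/
private theorem ι_appLE_comp_topIso_hom' {Y : Scheme.{u}} (V U : Y.Opens) (l : (⊤ : (V : Scheme.{u}).Opens) ≤ V.ι ⁻¹ᵁ U)
    (h : V ≤ U) : V.ι.appLE U ⊤ l ≫ V.topIso.hom = Y.presheaf.map (homOfLE h).op := by
  rw [Scheme.Opens.ι_appLE, Scheme.Opens.topIso_hom, ← Functor.map_comp]
  rfl

/-- If `a ≫ f = g` with `f` an open immersion and `g` maps an open `O` into `f(W)`, then `O ≤ a⁻¹W`.
[cite: StacksProject, Tag 04TP (glueing sheaves of modules)] -/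
private theorem le_preimage_of_comp_eq_of_mem_image' {T Y X : Scheme.{u}} (a : T ⟶ Y) (f : Y ⟶ X) [IsOpenImmersion f]
    (g : T ⟶ X) (hag : a ≫ f = g) (W : Y.Opens) (O : T.Opens) (h : ∀ t : T, t ∈ O → g t ∈ f ''ᵁ W) :
    O ≤ a ⁻¹ᵁ W := by
  intro t ht
  obtain ⟨w, hw, hfw⟩ := h t ht
  have hft : f (a t) = g t := by rw [← hag]; exact (Scheme.Hom.comp_apply a f t).symm
  have hwa : w = a t := f.isOpenEmbedding.injective (hfw.trans hft.symm)
  show a t ∈ W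
  rw [← hwa]
  exact hw

/-- The identification `β^*𝒪 ≅ 𝒪` whose inverse sends `1` to `η_β(1)` (★ `pullbackUnitComparison`, an isomorphism).
[cite: StacksProject, Tag 01AK] -/
private theorem exists_pullback_unit_iso {T T' : Scheme.{u}} (β : T' ⟶ T) :
    ∃ υ : (Scheme.Modules.pullback β).obj (SheafOfModules.unit T.ringCatSheaf) ≅ SheafOfModules.unit T'.ringCatSheaf,
      υ.inv.app ⊤ (1 : Γ(T', ⊤)) = unitSection β (SheafOfModules.unit T.ringCatSheaf) ⊤ (1 : Γ(T, ⊤)) := by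
  haveI := isIso_pullbackUnitComparison β
  exact ⟨asIso (pullbackUnitComparison β), Morphisms.inv_pullbackUnitComparison_app_top_one β⟩

/-- **The STEIN hypothesis of the glueing theorem for an iterated fibre product**: if every base change `X ×_S T' → T'`
of `f : X ⟶ S` is surjective on global functions, then so is every test object `(X ×_S Y) ×_Y T → T` of
`π := pr₂ : X ×_S Y → Y` (Mathlib `pullbackLeftPullbackSndIso : (X ×_S Y) ×_Y T ≅ X ×_S T`).  For an abelian scheme
`A → S` the hypothesis is ★ `baseChange_appTop_bijective`. [cite: MumfordAV1970, §5 Cor. 6 (p. 54)] -/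
theorem surjective_appTop_pullback_snd_pullback_snd {X Y S : Scheme.{u}} (f : X ⟶ S) (g : Y ⟶ S)
    (hf : ∀ ⦃T : Scheme.{u}⦄ (b : T ⟶ S), Function.Surjective (pullback.snd f b).appTop)
    ⦃T : Scheme.{u}⦄ (b : T ⟶ Y) : Function.Surjective (pullback.snd (pullback.snd f g) b).appTop := by
  rw [← pullbackLeftPullbackSndIso_hom_snd f g b, Scheme.Hom.comp_appTop]
  exact (ConcreteCategory.bijective_of_isIso (pullbackLeftPullbackSndIso f g b).hom.appTop).2.comp (hf (b ≫ g))

/-! ### The glueing theorem -/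

set_option maxHeartbeats 400000 in
/-- **Pair readings of rigidified charts on test objects** (the engine of `exists_hasRank_one_of_rigidified_baseCover`):
for a scheme `Z` over `X` (`φ : Z ⟶ X`), an open `V` of `Z` and two charts `j, j'` whose frame opens at `p, q` contain the
image of `V`, the VALUE `val(j,p; j',q) ∈ Γ(Z, V)` — the wedge transition function of the two frames through THE normalised
isomorphism between the two chart readings on the test object `X ×_B V` (★ `Modules/SectionNormalisedIso`, ★
`Modules/WedgeTransition`), read along the graph section — together with its calculus: multiplicativity
(★ `transitionDet_pair_mul`), normalisation, agreement with the frame cocycle of `L_i` when one chart is read against itself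
(★ `transitionDet_pair_self`), BASE CHANGE along any `θ : Z' ⟶ Z` (★ `transitionDet_pair_baseChange`, ★ `transport_comp`)
and compatibility with restriction. [cite: BoschLutkebohmertRaynaud1990, §8.1 Prop. 4]
[cite: MumfordAV1970, §13 (proof of the Thm. p. 125)] [cite: StacksProject, Tag 04TP (glueing sheaves of modules)] -/
theorem exists_pairReading {X B : Scheme.{u}} (π : X ⟶ B) (e : B ⟶ X) (he : e ≫ π = 𝟙 B)
    {ι : Type v} (Bc : ι → Scheme.{u}) (χ : ∀ i, Bc i ⟶ B) [∀ i, IsOpenImmersion (χ i)]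
    (Xc : ι → Scheme.{u}) (Ξ : ∀ i, Xc i ⟶ X) (πc : ∀ i, Xc i ⟶ Bc i)
    [∀ i, IsOpenImmersion (Ξ i)] (hcart : ∀ i, IsPullback (Ξ i) (πc i) π (χ i))
    (ec : ∀ i, Bc i ⟶ Xc i) (hec₁ : ∀ i, ec i ≫ Ξ i = χ i ≫ e) (hec₂ : ∀ i, ec i ≫ πc i = 𝟙 _)
    (L : ∀ i, (Xc i).Modules) (hL : ∀ i, HasRank (L i) 1)
    (r : ∀ i, (Scheme.Modules.pullback (ec i)).obj (L i) ≅ SheafOfModules.unit _)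
    (hStein : ∀ ⦃T : Scheme.{u}⦄ (b : T ⟶ B), Function.Surjective (pullback.snd π b).appTop)
    (hcompat : ∀ ⦃T : Scheme.{u}⦄ (b : T ⟶ B) (i j : ι) (mi : pullback π b ⟶ Xc i) (mj : pullback π b ⟶ Xc j),
      mi ≫ Ξ i = pullback.fst π b → mj ≫ Ξ j = pullback.fst π b →
      Nonempty ((Scheme.Modules.pullback mi).obj (L i) ≅ (Scheme.Modules.pullback mj).obj (L j)))
    (F : ∀ i, FrameSystem (L i)) :
    ∃ val : ∀ (Z : Scheme.{u}) (φ : Z ⟶ X) (V : Z.Opens) (j : ι) (p : Xc j) (j' : ι) (q : Xc j'),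
        (∀ v : (V : Scheme.{u}), (V.ι ≫ φ) v ∈ Ξ j ''ᵁ (F j).U p) →
        (∀ v : (V : Scheme.{u}), (V.ι ≫ φ) v ∈ Ξ j' ''ᵁ (F j').U q) → Γ(Z, V),
      (∀ (Z : Scheme.{u}) (φ : Z ⟶ X) (V : Z.Opens) (j : ι) (p : Xc j) (j' : ι) (q : Xc j')
        (j'' : ι) (o : Xc j'') (hp : ∀ v : (V : Scheme.{u}), (V.ι ≫ φ) v ∈ Ξ j ''ᵁ (F j).U p)
        (hq : ∀ v : (V : Scheme.{u}), (V.ι ≫ φ) v ∈ Ξ j' ''ᵁ (F j').U q)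
        (ho : ∀ v : (V : Scheme.{u}), (V.ι ≫ φ) v ∈ Ξ j'' ''ᵁ (F j'').U o),
        val Z φ V j p j' q hp hq * val Z φ V j' q j'' o hq ho = val Z φ V j p j'' o hp ho) ∧
      (∀ (Z : Scheme.{u}) (φ : Z ⟶ X) (V : Z.Opens) (j : ι) (p : Xc j)
        (hp : ∀ v : (V : Scheme.{u}), (V.ι ≫ φ) v ∈ Ξ j ''ᵁ (F j).U p), val Z φ V j p j p hp hp = 1) ∧
      (∀ (i : ι) (W : (Xc i).Opens) (p p' : Xc i)
        (hp : ∀ w : (W : Scheme.{u}), (W.ι ≫ (Ξ i ≫ 𝟙 X)) w ∈ Ξ i ''ᵁ (F i).U p)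
        (hp' : ∀ w : (W : Scheme.{u}), (W.ι ≫ (Ξ i ≫ 𝟙 X)) w ∈ Ξ i ''ᵁ (F i).U p') (h : W ≤ (F i).U p)
        (h' : W ≤ (F i).U p'), val (Xc i) (Ξ i ≫ 𝟙 X) W i p i p' hp hp' = (F i).cocycle.g p p' W h h') ∧
      (∀ (Z Z' : Scheme.{u}) (θ : Z' ⟶ Z) (φ : Z ⟶ X) (V : Z.Opens) (V' : Z'.Opens) (hθ : V' ≤ θ ⁻¹ᵁ V)
        (j : ι) (p : Xc j) (j' : ι) (q : Xc j')
        (hp : ∀ v : (V : Scheme.{u}), (V.ι ≫ φ) v ∈ Ξ j ''ᵁ (F j).U p)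
        (hq : ∀ v : (V : Scheme.{u}), (V.ι ≫ φ) v ∈ Ξ j' ''ᵁ (F j').U q)
        (hp' : ∀ v : (V' : Scheme.{u}), (V'.ι ≫ (θ ≫ φ)) v ∈ Ξ j ''ᵁ (F j).U p)
        (hq' : ∀ v : (V' : Scheme.{u}), (V'.ι ≫ (θ ≫ φ)) v ∈ Ξ j' ''ᵁ (F j').U q),
        θ.appLE V V' hθ (val Z φ V j p j' q hp hq) = val Z' (θ ≫ φ) V' j p j' q hp' hq') ∧
      (∀ (Z : Scheme.{u}) (φ : Z ⟶ X) (V V' : Z.Opens) (i : V' ≤ V) (j : ι) (p : Xc j) (j' : ι)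
        (q : Xc j') (hp : ∀ v : (V : Scheme.{u}), (V.ι ≫ φ) v ∈ Ξ j ''ᵁ (F j).U p)
        (hq : ∀ v : (V : Scheme.{u}), (V.ι ≫ φ) v ∈ Ξ j' ''ᵁ (F j').U q)
        (hp' : ∀ v : (V' : Scheme.{u}), (V'.ι ≫ φ) v ∈ Ξ j ''ᵁ (F j).U p)
        (hq' : ∀ v : (V' : Scheme.{u}), (V'.ι ≫ φ) v ∈ Ξ j' ''ᵁ (F j').U q),
        secRes Z i (val Z φ V j p j' q hp hq) = val Z φ V' j p j' q hp' hq') := by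
  classical
  haveI hfin : ∀ i (y : Xc i), Fintype ((F i).I y) := fun i y => Fintype.ofEquiv _ ((F i).enum y).symm
  /- §A  TEST OBJECTS.  For a scheme `Z` with `φ : Z ⟶ X` (used for `Z = X, φ = 𝟙` and `Z = Xᵢ, φ = Ξᵢ ≫ 𝟙`) and an open
    `V` of `Z`: `X_V := X ×_B V` (along `b_V := V.ι ≫ φ ≫ π`), its section `e_V`, the graph-section `s_V : V → X_V`, and for a
    chart `j` containing `π(φ(V))` the base lift `β` and the cartesian lift `m : X_V → X_j`. -/
  have hsec : ∀ (Z : Scheme.{u}) (φ : Z ⟶ X) (V : Z.Opens), ((V.ι ≫ φ ≫ π) ≫ e) ≫ π = 𝟙 _ ≫ (V.ι ≫ φ ≫ π) := by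
    intro Z φ V; rw [Category.assoc, he, Category.comp_id, Category.id_comp]
  have hgraph : ∀ (Z : Scheme.{u}) (φ : Z ⟶ X) (V : Z.Opens), (V.ι ≫ φ) ≫ π = 𝟙 _ ≫ (V.ι ≫ φ ≫ π) := by
    intro Z φ V; rw [Category.assoc, Category.id_comp]
  -- base lifts into a chart `j`, for opens whose image in `B` lies in `χ_j(B_j)`
  obtain ⟨β, hβ⟩ : ∃ β : ∀ (Z : Scheme.{u}) (φ : Z ⟶ X) (V : Z.Opens) (j : ι),
      Set.range (V.ι ≫ φ ≫ π) ⊆ Set.range (χ j) → ((V : Scheme.{u}) ⟶ Bc j),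
      ∀ Z φ V j h, β Z φ V j h ≫ χ j = V.ι ≫ φ ≫ π :=
    ⟨fun Z φ V j h => IsOpenImmersion.lift (χ j) (V.ι ≫ φ ≫ π) h, fun Z φ V j h => IsOpenImmersion.lift_fac _ _ _⟩
  have hmw : ∀ (Z : Scheme.{u}) (φ : Z ⟶ X) (V : Z.Opens) (j : ι) (h : Set.range (V.ι ≫ φ ≫ π) ⊆ Set.range (χ j)),
      pullback.fst π (V.ι ≫ φ ≫ π) ≫ π = (pullback.snd π (V.ι ≫ φ ≫ π) ≫ β Z φ V j h) ≫ χ j := by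
    intro Z φ V j h; rw [Category.assoc, hβ, pullback.condition]
  have hm₁ : ∀ Z φ V j h, (hcart j).lift _ _ (hmw Z φ V j h) ≫ Ξ j = pullback.fst π (V.ι ≫ φ ≫ π) :=
    fun Z φ V j h => (hcart j).lift_fst _ _ _
  have hm₂ : ∀ Z φ V j h, (hcart j).lift _ _ (hmw Z φ V j h) ≫ πc j = pullback.snd π (V.ι ≫ φ ≫ π) ≫ β Z φ V j h :=
    fun Z φ V j h => (hcart j).lift_snd _ _ _
  -- the square of sections `e_V ≫ m = β ≫ ec_j`
  have hsq : ∀ Z φ V j h, pullback.lift _ _ (hsec Z φ V) ≫ (hcart j).lift _ _ (hmw Z φ V j h) = β Z φ V j h ≫ ec j := by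
    intro Z φ V j h
    apply (hcart j).hom_ext
    · simp only [Category.assoc]
      rw [hm₁, pullback.lift_fst, hec₁, ← Category.assoc (β Z φ V j h), hβ Z φ V j h, Category.assoc, Category.assoc]
    · simp only [Category.assoc]
      rw [hm₂, pullback.lift_snd_assoc, Category.id_comp, hec₂, Category.comp_id]
  -- identifications `β^*𝒪 ≅ 𝒪`
  choose υ hυ using fun (Z : Scheme.{u}) (φ : Z ⟶ X) (V : Z.Opens) (j : ι)
    (h : Set.range (V.ι ≫ φ ≫ π) ⊆ Set.range (χ j)) => exists_pullback_unit_iso (β Z φ V j h)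
  -- THE normalised isomorphisms between two chart readings on the same test object
  have hΨex : ∀ (Z : Scheme.{u}) (φ : Z ⟶ X) (V : Z.Opens) (j j' : ι)
      (h : Set.range (V.ι ≫ φ ≫ π) ⊆ Set.range (χ j)) (h' : Set.range (V.ι ≫ φ ≫ π) ⊆ Set.range (χ j')),
      ∃ Ψ : (Scheme.Modules.pullback ((hcart j).lift _ _ (hmw Z φ V j h))).obj (L j) ≅
          (Scheme.Modules.pullback ((hcart j').lift _ _ (hmw Z φ V j' h'))).obj (L j'),
        (Scheme.Modules.pullback (pullback.lift _ _ (hsec Z φ V))).map Ψ.hom ≫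
          ((Scheme.Modules.pullbackComp (pullback.lift _ _ (hsec Z φ V)) ((hcart j').lift _ _ (hmw Z φ V j' h'))).app (L j') ≪≫
            (Scheme.Modules.pullbackCongr (hsq Z φ V j' h')).app (L j') ≪≫
            ((Scheme.Modules.pullbackComp (β Z φ V j' h') (ec j')).app (L j')).symm ≪≫
            (Scheme.Modules.pullback (β Z φ V j' h')).mapIso (r j') ≪≫ υ Z φ V j' h').hom =
          ((Scheme.Modules.pullbackComp (pullback.lift _ _ (hsec Z φ V)) ((hcart j).lift _ _ (hmw Z φ V j h))).app (L j) ≪≫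
            (Scheme.Modules.pullbackCongr (hsq Z φ V j h)).app (L j) ≪≫
            ((Scheme.Modules.pullbackComp (β Z φ V j h) (ec j)).app (L j)).symm ≪≫
            (Scheme.Modules.pullback (β Z φ V j h)).mapIso (r j) ≪≫ υ Z φ V j h).hom :=
    fun Z φ V j j' h h' => exists_iso_normalised (pullback.snd π (V.ι ≫ φ ≫ π)) (pullback.lift _ _ (hsec Z φ V))
      (pullback.lift_snd _ _ _) _ _ (hcompat _ j j' _ _ (hm₁ Z φ V j h) (hm₁ Z φ V j' h')).some
  choose Ψ hΨ using hΨex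
  /- §B  CHART READINGS OF FRAMES.  The open `O(j,p;j',q) := m⁻¹U_p ⊓ m'⁻¹U_q` of `X_V` and the fact that the graph section
    maps `V` into it when `φ(V) ⊆ Ξ_j(U_p) ∩ Ξ_{j'}(U_q)`. -/
  have hrange : ∀ (Z : Scheme.{u}) (φ : Z ⟶ X) (V : Z.Opens) (j : ι) (W : (Xc j).Opens),
      (∀ v : (V : Scheme.{u}), (V.ι ≫ φ) v ∈ Ξ j ''ᵁ W) → Set.range (V.ι ≫ φ ≫ π) ⊆ Set.range (χ j) := by
    intro Z φ V j W hV x hx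
    obtain ⟨v, rfl⟩ := hx
    obtain ⟨w, -, hw⟩ := hV v
    replace hw : (Ξ j) w = (V.ι ≫ φ) v := hw
    refine ⟨πc j w, ?_⟩
    rw [← Scheme.Hom.comp_apply, ← (hcart j).w, Scheme.Hom.comp_apply, hw]
    simp only [Scheme.Hom.comp_apply]
  have htop : ∀ (Z : Scheme.{u}) (φ : Z ⟶ X) (V : Z.Opens) (j : ι) (W : (Xc j).Opens)
      (hV : ∀ v : (V : Scheme.{u}), (V.ι ≫ φ) v ∈ Ξ j ''ᵁ W),
      (⊤ : (V : Scheme.{u}).Opens) ≤ (pullback.lift _ _ (hgraph Z φ V) ≫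
        (hcart j).lift _ _ (hmw Z φ V j (hrange Z φ V j W hV))) ⁻¹ᵁ W := by
    intro Z φ V j W hV
    refine le_preimage_of_comp_eq_of_mem_image' _ (Ξ j) (V.ι ≫ φ) ?_ W ⊤ fun v _ => hV v
    rw [Category.assoc, hm₁, pullback.lift_fst]
  -- the value read along the graph section: restating it on any smaller open of `X_V`
  have hval : ∀ (Z : Scheme.{u}) (φ : Z ⟶ X) (V : Z.Opens) {O O' : (pullback π (V.ι ≫ φ ≫ π)).Opens} (hO : O' ≤ O)
      (l : (⊤ : (V : Scheme.{u}).Opens) ≤ pullback.lift _ _ (hgraph Z φ V) ⁻¹ᵁ O)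
      (l' : (⊤ : (V : Scheme.{u}).Opens) ≤ pullback.lift _ _ (hgraph Z φ V) ⁻¹ᵁ O') (s : Γ(pullback π (V.ι ≫ φ ≫ π), O)),
      (pullback.lift _ _ (hgraph Z φ V)).appLE O ⊤ l s =
        (pullback.lift _ _ (hgraph Z φ V)).appLE O' ⊤ l' ((pullback π (V.ι ≫ φ ≫ π)).presheaf.map (homOfLE hO).op s) := by
    intro Z φ V O O' hO l l' s
    change _ = ((pullback π (V.ι ≫ φ ≫ π)).presheaf.map (homOfLE hO).op ≫ Scheme.Hom.appLE _ O' ⊤ l') s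
    rw [Scheme.Hom.map_appLE]
  /- §C  THE VALUE `val(j,p; j',q) ∈ Γ(Z, V)`: the pair transition function of the frames at `p` (chart `j`) and `q`
    (chart `j'`), through THE normalised isomorphism, read along the graph section. -/
  obtain ⟨val, hvaldef⟩ : ∃ val : ∀ (Z : Scheme.{u}) (φ : Z ⟶ X) (V : Z.Opens) (j : ι) (p : Xc j) (j' : ι)
      (q : Xc j'), (∀ v : (V : Scheme.{u}), (V.ι ≫ φ) v ∈ Ξ j ''ᵁ (F j).U p) →
      (∀ v : (V : Scheme.{u}), (V.ι ≫ φ) v ∈ Ξ j' ''ᵁ (F j').U q) → Γ(Z, V),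
      ∀ Z φ V j p j' q hp hq, val Z φ V j p j' q hp hq = V.topIso.hom
        ((pullback.lift _ _ (hgraph Z φ V)).appLE
          ((hcart j).lift _ _ (hmw Z φ V j (hrange Z φ V j _ hp)) ⁻¹ᵁ (F j).U p ⊓
            (hcart j').lift _ _ (hmw Z φ V j' (hrange Z φ V j' _ hq)) ⁻¹ᵁ (F j').U q) ⊤
          (le_inf (htop Z φ V j _ hp) (htop Z φ V j' _ hq))
          (transitionDet (pullbackFrame ((hcart j).lift _ _ (hmw Z φ V j (hrange Z φ V j _ hp))) ((F j).frame p) ≪≫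
              (SheafOfModules.overFunctor _ _).mapIso (Ψ Z φ V j j' (hrange Z φ V j _ hp) (hrange Z φ V j' _ hq)))
            (pullbackFrame ((hcart j').lift _ _ (hmw Z φ V j' (hrange Z φ V j' _ hq))) ((F j').frame q))
            ((F j).enum p) ((F j').enum q) (homOfLE inf_le_left) (homOfLE inf_le_right))) := ⟨_, fun _ _ _ _ _ _ _ _ _ => rfl⟩
  -- (C1) multiplicativity on one test object (★ `transitionDet_pair_mul`)
  have hmul : ∀ (Z : Scheme.{u}) (φ : Z ⟶ X) (V : Z.Opens) (j : ι) (p : Xc j) (j' : ι) (q : Xc j')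
      (j'' : ι) (o : Xc j'') (hp : ∀ v : (V : Scheme.{u}), (V.ι ≫ φ) v ∈ Ξ j ''ᵁ (F j).U p)
      (hq : ∀ v : (V : Scheme.{u}), (V.ι ≫ φ) v ∈ Ξ j' ''ᵁ (F j').U q)
      (ho : ∀ v : (V : Scheme.{u}), (V.ι ≫ φ) v ∈ Ξ j'' ''ᵁ (F j'').U o),
      val Z φ V j p j' q hp hq * val Z φ V j' q j'' o hq ho = val Z φ V j p j'' o hp ho := by
    intro Z φ V j p j' q j'' o hp hq ho
    rw [hvaldef, hvaldef, hvaldef,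
      hval Z φ V (O' := (hcart j).lift _ _ (hmw Z φ V j (hrange Z φ V j _ hp)) ⁻¹ᵁ (F j).U p ⊓
          (hcart j').lift _ _ (hmw Z φ V j' (hrange Z φ V j' _ hq)) ⁻¹ᵁ (F j').U q ⊓
          (hcart j'').lift _ _ (hmw Z φ V j'' (hrange Z φ V j'' _ ho)) ⁻¹ᵁ (F j'').U o)
        inf_le_left _
        (le_inf (le_inf (htop Z φ V j _ hp) (htop Z φ V j' _ hq)) (htop Z φ V j'' _ ho)),
      hval Z φ V (O' := (hcart j).lift _ _ (hmw Z φ V j (hrange Z φ V j _ hp)) ⁻¹ᵁ (F j).U p ⊓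
          (hcart j').lift _ _ (hmw Z φ V j' (hrange Z φ V j' _ hq)) ⁻¹ᵁ (F j').U q ⊓
          (hcart j'').lift _ _ (hmw Z φ V j'' (hrange Z φ V j'' _ ho)) ⁻¹ᵁ (F j'').U o)
        (le_inf (le_trans inf_le_left inf_le_right) inf_le_right) _
        (le_inf (le_inf (htop Z φ V j _ hp) (htop Z φ V j' _ hq)) (htop Z φ V j'' _ ho)),
      hval Z φ V (O' := (hcart j).lift _ _ (hmw Z φ V j (hrange Z φ V j _ hp)) ⁻¹ᵁ (F j).U p ⊓
          (hcart j').lift _ _ (hmw Z φ V j' (hrange Z φ V j' _ hq)) ⁻¹ᵁ (F j').U q ⊓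
          (hcart j'').lift _ _ (hmw Z φ V j'' (hrange Z φ V j'' _ ho)) ⁻¹ᵁ (F j'').U o)
        (le_inf (le_trans inf_le_left inf_le_left) inf_le_right) _
        (le_inf (le_inf (htop Z φ V j _ hp) (htop Z φ V j' _ hq)) (htop Z φ V j'' _ ho)),
      ← map_mul, ← map_mul, transitionDet_map, transitionDet_map, transitionDet_map]
    congr 2
    exact transitionDet_pair_mul (pullback.snd π (V.ι ≫ φ ≫ π)) (pullback.lift _ _ (hsec Z φ V))
      (pullback.lift_snd _ _ _) _ _ _ _ _ _ _ _ _ (hStein _) (hL j) _ _ _ _ _ _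
      (hΨ Z φ V j j' _ _) (hΨ Z φ V j' j'' _ _) (hΨ Z φ V j j'' _ _) _ _ _
  -- (C2) normalisation `val(j,p; j,p) = 1`
  have hone : ∀ (Z : Scheme.{u}) (φ : Z ⟶ X) (V : Z.Opens) (j : ι) (p : Xc j)
      (hp : ∀ v : (V : Scheme.{u}), (V.ι ≫ φ) v ∈ Ξ j ''ᵁ (F j).U p), val Z φ V j p j p hp hp = 1 := by
    intro Z φ V j p hp
    have hu : IsUnit (val Z φ V j p j p hp hp) := by
      rw [hvaldef]
      exact ((isUnit_transitionDet _ _ _ _ _ _).map _).map _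
    obtain ⟨w, hw⟩ := hu
    have key := hmul Z φ V j p j p j p hp hp hp
    rw [← hw, ← Units.val_mul, ← Units.ext_iff, mul_eq_left] at key
    rw [← hw, key, Units.val_one]
  -- (C3) a chart read against itself: the value is the restricted frame transition function
  have hself : ∀ (i : ι) (W : (Xc i).Opens) (p p' : Xc i)
      (hp : ∀ w : (W : Scheme.{u}), (W.ι ≫ (Ξ i ≫ 𝟙 X)) w ∈ Ξ i ''ᵁ (F i).U p)
      (hp' : ∀ w : (W : Scheme.{u}), (W.ι ≫ (Ξ i ≫ 𝟙 X)) w ∈ Ξ i ''ᵁ (F i).U p') (hW : W ≤ (F i).U p ⊓ (F i).U p'),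
      val (Xc i) (Ξ i ≫ 𝟙 X) W i p i p' hp hp' =
        (Xc i).presheaf.map (homOfLE hW).op (transitionDet ((F i).frame p) ((F i).frame p') ((F i).enum p)
          ((F i).enum p') (homOfLE inf_le_left) (homOfLE inf_le_right)) := by
    intro i W p p' hp hp' hW
    -- the graph section followed by the chart reading is `W.ι`
    have hβ' : β (Xc i) (Ξ i ≫ 𝟙 X) W i (hrange _ _ W i _ hp) = W.ι ≫ πc i := by
      rw [← cancel_mono (χ i), hβ]
      simp only [Category.assoc]
      rw [← (hcart i).w, Category.id_comp]
    have hsm : pullback.lift _ _ (hgraph (Xc i) (Ξ i ≫ 𝟙 X) W) ≫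
        (hcart i).lift _ _ (hmw _ _ W i (hrange _ _ W i _ hp)) = W.ι := by
      apply (hcart i).hom_ext
      · rw [Category.assoc, hm₁, pullback.lift_fst, Category.comp_id]
      · rw [Category.assoc, hm₂, pullback.lift_snd_assoc, Category.id_comp, hβ']
    rw [hvaldef, transitionDet_pair_self (pullback.snd π (W.ι ≫ (Ξ i ≫ 𝟙 X) ≫ π))
      (pullback.lift _ _ (hsec (Xc i) (Ξ i ≫ 𝟙 X) W)) (pullback.lift_snd _ _ _) _ _ _ (hStein _) (hL i) _ _ _ _
      (hΨ _ _ W i i _ _) (le_inf inf_le_left inf_le_right)]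
    change (Scheme.Hom.appLE _ _ _ _ ≫ Scheme.Hom.appLE _ _ ⊤ _ ≫ W.topIso.hom) _ = _
    rw [Scheme.Hom.appLE_comp_appLE_assoc _ _ _ _ ⊤ _ _]
    have key : ∀ (a : (W : Scheme.{u}) ⟶ Xc i) (ha : a = W.ι) (l : ⊤ ≤ a ⁻¹ᵁ ((F i).U p ⊓ (F i).U p')),
        a.appLE ((F i).U p ⊓ (F i).U p') ⊤ l ≫ W.topIso.hom = (Xc i).presheaf.map (homOfLE hW).op := by
      intro a ha l; subst ha; exact ι_appLE_comp_topIso_hom' W _ l hW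
    rw [key _ hsm]
  /- (C4) BASE CHANGE along `θ : Z' ⟶ Z` (`V' ≤ θ⁻¹V`): `θ^♯ val_Z(V) = val_{Z'}(V')` — the morphism of test objects
    `g : X_{V'} ⟶ X_V` over `θ|_{V'}`, ★ `transitionDet_pair_baseChange` and ★ `transitionDet_pair_congr`. -/
  have hres : ∀ (Z Z' : Scheme.{u}) (θ : Z' ⟶ Z) (φ : Z ⟶ X) (V : Z.Opens) (V' : Z'.Opens) (hθ : V' ≤ θ ⁻¹ᵁ V)
      (j : ι) (p : Xc j) (j' : ι) (q : Xc j')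
      (hp : ∀ v : (V : Scheme.{u}), (V.ι ≫ φ) v ∈ Ξ j ''ᵁ (F j).U p)
      (hq : ∀ v : (V : Scheme.{u}), (V.ι ≫ φ) v ∈ Ξ j' ''ᵁ (F j').U q)
      (hp' : ∀ v : (V' : Scheme.{u}), (V'.ι ≫ (θ ≫ φ)) v ∈ Ξ j ''ᵁ (F j).U p)
      (hq' : ∀ v : (V' : Scheme.{u}), (V'.ι ≫ (θ ≫ φ)) v ∈ Ξ j' ''ᵁ (F j').U q),
      θ.appLE V V' hθ (val Z φ V j p j' q hp hq) = val Z' (θ ≫ φ) V' j p j' q hp' hq' := by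
    intro Z Z' θ φ V V' hθ j p j' q hp hq hp' hq'
    -- the morphism of test objects `g : X_{V'} ⟶ X_V` over `t := θ|_{V'}`
    have hbt : θ.resLE V V' hθ ≫ V.ι ≫ φ ≫ π = V'.ι ≫ (θ ≫ φ) ≫ π := by
      simp only [Scheme.Hom.resLE_comp_ι_assoc, Category.assoc]
    have hgw : pullback.fst π (V'.ι ≫ (θ ≫ φ) ≫ π) ≫ π =
        (pullback.snd π (V'.ι ≫ (θ ≫ φ) ≫ π) ≫ θ.resLE V V' hθ) ≫ (V.ι ≫ φ ≫ π) :=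
      calc _ = pullback.snd π (V'.ι ≫ (θ ≫ φ) ≫ π) ≫ (V'.ι ≫ (θ ≫ φ) ≫ π) := pullback.condition
        _ = pullback.snd π (V'.ι ≫ (θ ≫ φ) ≫ π) ≫ (θ.resLE V V' hθ ≫ V.ι ≫ φ ≫ π) := by rw [hbt]
        _ = _ := (Category.assoc _ _ _).symm
    have hgs : θ.resLE V V' hθ ≫ pullback.lift _ _ (hgraph Z φ V) =
        pullback.lift _ _ (hgraph Z' (θ ≫ φ) V') ≫ pullback.lift _ _ hgw := by
      apply pullback.hom_ext
      · simp only [Category.assoc, pullback.lift_fst, Scheme.Hom.resLE_comp_ι_assoc]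
      · simp only [Category.assoc, pullback.lift_snd, pullback.lift_snd_assoc, Category.comp_id, Category.id_comp]
    have hge : pullback.lift _ _ (hsec Z' (θ ≫ φ) V') ≫ pullback.lift _ _ hgw =
        θ.resLE V V' hθ ≫ pullback.lift _ _ (hsec Z φ V) := by
      apply pullback.hom_ext
      · simp only [Category.assoc, pullback.lift_fst, Scheme.Hom.resLE_comp_ι_assoc]
      · simp only [Category.assoc, pullback.lift_snd, pullback.lift_snd_assoc, Category.id_comp, Category.comp_id]
    have hβt : ∀ (j : ι) (h : Set.range (V.ι ≫ φ ≫ π) ⊆ Set.range (χ j))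
        (h' : Set.range (V'.ι ≫ (θ ≫ φ) ≫ π) ⊆ Set.range (χ j)),
        θ.resLE V V' hθ ≫ β Z φ V j h = β Z' (θ ≫ φ) V' j h' := by
      intro j h h'
      rw [← cancel_mono (χ j), Category.assoc, hβ, hβ, hbt]
    have hgm : ∀ (j : ι) (h : Set.range (V.ι ≫ φ ≫ π) ⊆ Set.range (χ j))
        (h' : Set.range (V'.ι ≫ (θ ≫ φ) ≫ π) ⊆ Set.range (χ j)),
        pullback.lift _ _ hgw ≫ (hcart j).lift _ _ (hmw Z φ V j h) = (hcart j).lift _ _ (hmw Z' (θ ≫ φ) V' j h') := by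
      intro j h h'
      apply (hcart j).hom_ext
      · simp only [Category.assoc, hm₁, pullback.lift_fst]
      · simp only [Category.assoc, hm₂, pullback.lift_snd_assoc, hβt j h h']
    -- the opens: `g⁻¹(m⁻¹U_p ⊓ m'⁻¹U_q)` lies in the frame opens read through the `V'`-readings
    have hk : ∀ (j : ι) (W : (Xc j).Opens) (h : Set.range (V.ι ≫ φ ≫ π) ⊆ Set.range (χ j))
        (h' : Set.range (V'.ι ≫ (θ ≫ φ) ≫ π) ⊆ Set.range (χ j)) (O : (pullback π (V.ι ≫ φ ≫ π)).Opens),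
        O ≤ (hcart j).lift _ _ (hmw Z φ V j h) ⁻¹ᵁ W →
        pullback.lift _ _ hgw ⁻¹ᵁ O ≤ (hcart j).lift _ _ (hmw Z' (θ ≫ φ) V' j h') ⁻¹ᵁ W := by
      intro j W h h' O hO
      rw [← hgm j h h', Scheme.Hom.comp_preimage]
      exact fun _ hx => hO hx
    have hk' : ∀ (j : ι) (W : (Xc j).Opens) (h : Set.range (V.ι ≫ φ ≫ π) ⊆ Set.range (χ j))
        (O : (pullback π (V.ι ≫ φ ≫ π)).Opens), O ≤ (hcart j).lift _ _ (hmw Z φ V j h) ⁻¹ᵁ W →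
        pullback.lift _ _ hgw ⁻¹ᵁ O ≤ (pullback.lift _ _ hgw ≫ (hcart j).lift _ _ (hmw Z φ V j h)) ⁻¹ᵁ W := by
      intro j W h O hO
      rw [Scheme.Hom.comp_preimage]
      exact fun _ hx => hO hx
    -- identifications `t^*𝒪 ≅ 𝒪` and `(t ≫ β)^*𝒪 ≅ 𝒪`
    obtain ⟨υt, hυt⟩ := exists_pullback_unit_iso (θ.resLE V V' hθ)
    obtain ⟨υ₁', hυ₁'⟩ := exists_pullback_unit_iso (θ.resLE V V' hθ ≫ β Z φ V j (hrange Z φ V j _ hp))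
    obtain ⟨υ₂', hυ₂'⟩ := exists_pullback_unit_iso (θ.resLE V V' hθ ≫ β Z φ V j' (hrange Z φ V j' _ hq))
    -- THE normalised isomorphism for the composite readings `g ≫ m`, `g ≫ m'` (directly transported rigidifications)
    obtain ⟨Ψ', n'⟩ := exists_iso_normalised (pullback.snd π (V'.ι ≫ (θ ≫ φ) ≫ π))
      (pullback.lift _ _ (hsec Z' (θ ≫ φ) V')) (pullback.lift_snd _ _ _)
      ((Scheme.Modules.pullbackComp (pullback.lift _ _ (hsec Z' (θ ≫ φ) V'))
          (pullback.lift _ _ hgw ≫ (hcart j).lift _ _ (hmw Z φ V j (hrange Z φ V j _ hp)))).app (L j) ≪≫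
        (Scheme.Modules.pullbackCongr (sq_comp (ec j) _ _ _ (hsq Z φ V j (hrange Z φ V j _ hp)) _ _ _ hge)).app (L j) ≪≫
        ((Scheme.Modules.pullbackComp (θ.resLE V V' hθ ≫ β Z φ V j (hrange Z φ V j _ hp)) (ec j)).app (L j)).symm ≪≫
        (Scheme.Modules.pullback (θ.resLE V V' hθ ≫ β Z φ V j (hrange Z φ V j _ hp))).mapIso (r j) ≪≫ υ₁')
      ((Scheme.Modules.pullbackComp (pullback.lift _ _ (hsec Z' (θ ≫ φ) V'))
          (pullback.lift _ _ hgw ≫ (hcart j').lift _ _ (hmw Z φ V j' (hrange Z φ V j' _ hq)))).app (L j') ≪≫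
        (Scheme.Modules.pullbackCongr (sq_comp (ec j') _ _ _ (hsq Z φ V j' (hrange Z φ V j' _ hq)) _ _ _ hge)).app (L j') ≪≫
        ((Scheme.Modules.pullbackComp (θ.resLE V V' hθ ≫ β Z φ V j' (hrange Z φ V j' _ hq)) (ec j')).app (L j')).symm ≪≫
        (Scheme.Modules.pullback (θ.resLE V V' hθ ≫ β Z φ V j' (hrange Z φ V j' _ hq))).mapIso (r j') ≪≫ υ₂')
      (hcompat _ j j' _ _ (by simp only [Category.assoc, hm₁, pullback.lift_fst])
        (by simp only [Category.assoc, hm₁, pullback.lift_fst])).some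
    -- base change (★ `transitionDet_pair_baseChange`) and alignment of the readings (★ `transitionDet_pair_congr`)
    have hbc := transitionDet_pair_baseChange (pullback.lift _ _ (hsec Z φ V))
      (pullback.snd π (V'.ι ≫ (θ ≫ φ) ≫ π)) (pullback.lift _ _ (hsec Z' (θ ≫ φ) V')) (pullback.lift_snd _ _ _)
      (pullback.lift _ _ hgw) (θ.resLE V V' hθ) hge υt hυt (ec j) (ec j') (r j) (r j')
      ((hcart j).lift _ _ (hmw Z φ V j (hrange Z φ V j _ hp))) (β Z φ V j (hrange Z φ V j _ hp))
      (hsq Z φ V j (hrange Z φ V j _ hp))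
      ((hcart j').lift _ _ (hmw Z φ V j' (hrange Z φ V j' _ hq))) (β Z φ V j' (hrange Z φ V j' _ hq))
      (hsq Z φ V j' (hrange Z φ V j' _ hq)) _ (hυ _ _ _ _ _) _ (hυ _ _ _ _ _)
      υ₁' hυ₁' υ₂' hυ₂' ((F j).frame p) ((F j').frame q) ((F j).enum p) ((F j').enum q) (hStein _) (hL j) (hL j')
      _ (hΨ Z φ V j j' _ _) Ψ' n'
      (O := (hcart j).lift _ _ (hmw Z φ V j (hrange Z φ V j _ hp)) ⁻¹ᵁ (F j).U p ⊓
        (hcart j').lift _ _ (hmw Z φ V j' (hrange Z φ V j' _ hq)) ⁻¹ᵁ (F j').U q)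
      (homOfLE inf_le_left) (homOfLE inf_le_right) le_rfl
      (homOfLE (hk' j _ _ _ inf_le_left)) (homOfLE (hk' j' _ _ _ inf_le_right))
    have hcg := transitionDet_pair_congr (pullback.snd π (V'.ι ≫ (θ ≫ φ) ≫ π)) (pullback.lift _ _ (hsec Z' (θ ≫ φ) V'))
      (ec j) (ec j') (r j) (r j') _ _ (sq_comp (ec j) _ _ _ (hsq Z φ V j (hrange Z φ V j _ hp)) _ _ _ hge) _ _
      (sq_comp (ec j') _ _ _ (hsq Z φ V j' (hrange Z φ V j' _ hq)) _ _ _ hge) υ₁' hυ₁' υ₂' hυ₂'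
      ((F j).frame p) ((F j').frame q) ((F j).enum p) ((F j').enum q) (pullback.lift_snd _ _ _) (hStein _) (hL j)
      (hgm j _ (hrange Z' (θ ≫ φ) V' j _ hp')) (hβt j _ (hrange Z' (θ ≫ φ) V' j _ hp'))
      (hgm j' _ (hrange Z' (θ ≫ φ) V' j' _ hq')) (hβt j' _ (hrange Z' (θ ≫ φ) V' j' _ hq'))
      (hsq Z' (θ ≫ φ) V' j _) (hsq Z' (θ ≫ φ) V' j' _) _ (hυ _ _ _ _ _) _ (hυ _ _ _ _ _) Ψ' n'
      _ (hΨ Z' (θ ≫ φ) V' j j' _ _)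
      (homOfLE (hk' j _ _ _ inf_le_left)) (homOfLE (hk' j' _ _ _ inf_le_right))
      (homOfLE (hk j _ _ (hrange Z' (θ ≫ φ) V' j _ hp') _ inf_le_left))
      (homOfLE (hk j' _ _ (hrange Z' (θ ≫ φ) V' j' _ hq') _ inf_le_right))
    -- reading along `s_V` then applying `θ^♯` is reading the `g^♯`-image along `s_{V'}` (`t ≫ s_V = s_{V'} ≫ g`)
    have key : ∀ (a b : (V' : Scheme.{u}) ⟶ pullback π (V.ι ≫ φ ≫ π)) (hab : a = b)
        (O : (pullback π (V.ι ≫ φ ≫ π)).Opens) (la : ⊤ ≤ a ⁻¹ᵁ O) (s : Γ(pullback π (V.ι ≫ φ ≫ π), O)),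
        a.appLE O ⊤ la s = b.appLE O ⊤ (hab ▸ la) s := by
      intro a b hab O la s; subst hab; rfl
    have hl' : ∀ (O : (pullback π (V.ι ≫ φ ≫ π)).Opens), ⊤ ≤ pullback.lift _ _ (hgraph Z φ V) ⁻¹ᵁ O →
        ⊤ ≤ pullback.lift _ _ (hgraph Z' (θ ≫ φ) V') ⁻¹ᵁ (pullback.lift _ _ hgw ⁻¹ᵁ O) := by
      intro O l
      rw [← Scheme.Hom.comp_preimage, ← hgs, Scheme.Hom.comp_preimage]
      exact fun v _ => l (Set.mem_univ _)
    have hread : ∀ (O : (pullback π (V.ι ≫ φ ≫ π)).Opens) (l : ⊤ ≤ pullback.lift _ _ (hgraph Z φ V) ⁻¹ᵁ O)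
        (s : Γ(pullback π (V.ι ≫ φ ≫ π), O)),
        θ.appLE V V' hθ (V.topIso.hom ((pullback.lift _ _ (hgraph Z φ V)).appLE O ⊤ l s)) =
          V'.topIso.hom ((pullback.lift _ _ (hgraph Z' (θ ≫ φ) V')).appLE (pullback.lift _ _ hgw ⁻¹ᵁ O) ⊤ (hl' O l)
            ((pullback.lift _ _ hgw).appLE O (pullback.lift _ _ hgw ⁻¹ᵁ O) le_rfl s)) := by
      intro O l s
      change (V.topIso.hom ≫ θ.appLE V V' hθ) ((pullback.lift _ _ (hgraph Z φ V)).appLE O ⊤ l s) = _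
      rw [topIso_hom_comp_appLE' θ hθ]
      change V'.topIso.hom (((pullback.lift _ _ (hgraph Z φ V)).appLE O ⊤ l ≫
        (θ.resLE V V' hθ).appLE ⊤ ⊤ le_top) s) = _
      rw [Scheme.Hom.appLE_comp_appLE, key _ _ hgs,
        ← Scheme.Hom.appLE_comp_appLE _ _ _ (pullback.lift _ _ hgw ⁻¹ᵁ O) ⊤ le_rfl (hl' O l)]
      rfl
    have hbcg := hbc.trans hcg
    rw [hvaldef, hvaldef, hval Z' (θ ≫ φ) V' (O' := pullback.lift _ _ hgw ⁻¹ᵁ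
        ((hcart j).lift _ _ (hmw Z φ V j (hrange Z φ V j _ hp)) ⁻¹ᵁ (F j).U p ⊓
          (hcart j').lift _ _ (hmw Z φ V j' (hrange Z φ V j' _ hq)) ⁻¹ᵁ (F j').U q))
      (le_inf (hk j _ _ (hrange Z' (θ ≫ φ) V' j _ hp') _ inf_le_left)
        (hk j' _ _ (hrange Z' (θ ≫ φ) V' j' _ hq') _ inf_le_right)) _
      (hl' _ (le_inf (htop Z φ V j _ hp) (htop Z φ V j' _ hq)))]
    refine (hread _ _ _).trans ?_
    congr 2
    -- (never let `rw` compare sections over the two different pullback schemes: unfolding `pullback` is fatal)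
    refine hbcg.trans ?_
    exact (transitionDet_congr_hom _ _ _ _ _ _ _ _).trans (transitionDet_map _ _ _ _ _ _ _).symm
  -- (C5) restriction inside one scheme (`θ = 𝟙`) and independence of the bookkeeping morphism `φ`
  have hcongr : ∀ (Z : Scheme.{u}) (φ φ' : Z ⟶ X) (_ : φ = φ') (V : Z.Opens) (j : ι) (p : Xc j) (j' : ι)
      (q : Xc j') hp hq hp' hq', val Z φ V j p j' q hp hq = val Z φ' V j p j' q hp' hq' := by
    intro Z φ φ' hφ V j p j' q hp hq hp' hq'; subst hφ; rfl
  have hresId : ∀ (Z : Scheme.{u}) (φ : Z ⟶ X) (V V' : Z.Opens) (i : V' ≤ V) (j : ι) (p : Xc j) (j' : ι)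
      (q : Xc j') (hp : ∀ v : (V : Scheme.{u}), (V.ι ≫ φ) v ∈ Ξ j ''ᵁ (F j).U p)
      (hq : ∀ v : (V : Scheme.{u}), (V.ι ≫ φ) v ∈ Ξ j' ''ᵁ (F j').U q)
      (hp' : ∀ v : (V' : Scheme.{u}), (V'.ι ≫ φ) v ∈ Ξ j ''ᵁ (F j).U p)
      (hq' : ∀ v : (V' : Scheme.{u}), (V'.ι ≫ φ) v ∈ Ξ j' ''ᵁ (F j').U q),
      secRes Z i (val Z φ V j p j' q hp hq) = val Z φ V' j p j' q hp' hq' := by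
    intro Z φ V V' i j p j' q hp hq hp' hq'
    have h1 : ∀ s : Γ(Z, V), secRes Z i s = (𝟙 Z : Z ⟶ Z).appLE V V' i s := by
      intro s
      change _ = ((𝟙 Z : Z ⟶ Z).app V ≫ Z.presheaf.map (homOfLE i).op) s
      rw [Scheme.Hom.id_app, Category.id_comp]
    have hp'' : ∀ v : (V' : Scheme.{u}), (V'.ι ≫ (𝟙 Z ≫ φ)) v ∈ Ξ j ''ᵁ (F j).U p := by
      rw [Category.id_comp]; exact hp'
    have hq'' : ∀ v : (V' : Scheme.{u}), (V'.ι ≫ (𝟙 Z ≫ φ)) v ∈ Ξ j' ''ᵁ (F j').U q := by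
      rw [Category.id_comp]; exact hq'
    rw [h1, hres Z Z (𝟙 Z) φ V V' i j p j' q hp hq hp'' hq'']
    exact hcongr Z _ _ (Category.id_comp φ) V' j p j' q _ _ _ _
  refine ⟨val, hmul, hone, fun i W p p' hp hp' h h' => ?_, hres, hresId⟩
  exact (hself i W p p' hp hp' (le_inf h h')).trans
    ((transitionDet_map _ _ _ _ _ _ _).trans (transitionDet_congr_hom _ _ _ _ _ _ _ _))

/-- **THE RIGIDIFIED RANK-ONE FUNCTOR IS A ZARISKI SHEAF ON THE BASE (effectivity).**  Let `π : X ⟶ B` have a section `e`,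
let `χᵢ : Bᵢ → B` be open immersions and `Ξᵢ : Xᵢ → X` open immersions COVERING `X`, cartesian over the `χᵢ`
(`IsPullback (Ξᵢ) (πᵢ) π (χᵢ)`), with sections `ecᵢ : Bᵢ → Xᵢ` (`ecᵢ ≫ Ξᵢ = χᵢ ≫ e`, `ecᵢ ≫ πᵢ = 𝟙`); let `Lᵢ` be rank-one
modules on the `Xᵢ` rigidified along the `ecᵢ` (`rᵢ : ecᵢ^*Lᵢ ≅ 𝒪`).  Suppose that every projection `X ×_B T → T` is surjective
on global functions (STEIN) and that on every `X ×_B T` any two chart readings `mᵢ^*Lᵢ`, `mⱼ^*Lⱼ` (`mᵢ ≫ Ξᵢ = mⱼ ≫ Ξⱼ =` the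
projection to `X`) are isomorphic (COMPATIBILITY, class level).  Then there is a rank-one `𝒪_X`-module `P` with `Ξᵢ^*P ≅ Lᵢ`
for every `i` — the local rigidified families glue.  [cite: BoschLutkebohmertRaynaud1990, §8.1 Prop. 4]
[cite: MumfordAV1970, §13 (proof of the Thm. p. 125)] [cite: StacksProject, Tag 04TP (glueing sheaves of modules)] -/
theorem exists_hasRank_one_of_rigidified_baseCover {X B : Scheme.{u}} (π : X ⟶ B) (e : B ⟶ X) (he : e ≫ π = 𝟙 B)
    {ι : Type v} (Bc : ι → Scheme.{u}) (χ : ∀ i, Bc i ⟶ B) [∀ i, IsOpenImmersion (χ i)]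
    (Xc : ι → Scheme.{u}) (Ξ : ∀ i, Xc i ⟶ X) (πc : ∀ i, Xc i ⟶ Bc i)
    [∀ i, IsOpenImmersion (Ξ i)] (hcart : ∀ i, IsPullback (Ξ i) (πc i) π (χ i))
    (hcov : ∀ x : X, ∃ (i : ι) (z : Xc i), Ξ i z = x)
    (ec : ∀ i, Bc i ⟶ Xc i) (hec₁ : ∀ i, ec i ≫ Ξ i = χ i ≫ e) (hec₂ : ∀ i, ec i ≫ πc i = 𝟙 _)
    (L : ∀ i, (Xc i).Modules) (hL : ∀ i, HasRank (L i) 1)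
    (r : ∀ i, (Scheme.Modules.pullback (ec i)).obj (L i) ≅ SheafOfModules.unit _)
    (hStein : ∀ ⦃T : Scheme.{u}⦄ (b : T ⟶ B), Function.Surjective (pullback.snd π b).appTop)
    (hcompat : ∀ ⦃T : Scheme.{u}⦄ (b : T ⟶ B) (i j : ι) (mi : pullback π b ⟶ Xc i) (mj : pullback π b ⟶ Xc j),
      mi ≫ Ξ i = pullback.fst π b → mj ≫ Ξ j = pullback.fst π b →
      Nonempty ((Scheme.Modules.pullback mi).obj (L i) ≅ (Scheme.Modules.pullback mj).obj (L j))) :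
    ∃ P : X.Modules, HasRank P 1 ∧ ∀ i, Nonempty ((Scheme.Modules.pullback (Ξ i)).obj P ≅ L i) := by
  classical
  choose F hF using fun i => exists_frameSystem_of_hasRank (hL i)
  haveI hfin : ∀ i (y : Xc i), Fintype ((F i).I y) := fun i y => Fintype.ofEquiv _ ((F i).enum y).symm
  choose κ z hz using hcov
  obtain ⟨val, hmul, hone, hself, hres, hresId⟩ :=
    exists_pairReading π e he Bc χ Xc Ξ πc hcart ec hec₁ hec₂ L hL r hStein hcompat F
  /- §D  THE COCYCLE ON `X` and the glued module (the cover `U_x := Ξ_{κ x}(frame open at z x)` kept opaque). -/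
  obtain ⟨Ux, hUx⟩ : ∃ Ux : X → X.Opens, ∀ x, Ux x = Ξ (κ x) ''ᵁ (F (κ x)).U (z x) := ⟨_, fun _ => rfl⟩
  have hmemV : ∀ (x : X) (V : X.Opens), V ≤ Ux x →
      ∀ v : (V : Scheme.{u}), (V.ι ≫ 𝟙 X) v ∈ Ξ (κ x) ''ᵁ (F (κ x)).U (z x) := by
    intro x V hV v
    rw [Category.comp_id, Scheme.Opens.ι_apply, ← hUx]
    exact hV v.2
  let c : UnitCocycle X :=
    { U := Ux
      mem := fun x => by rw [hUx]; exact ⟨z x, (F (κ x)).mem (z x), hz x⟩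
      g := fun x y V hx hy => val X (𝟙 X) V (κ x) (z x) (κ y) (z y) (hmemV x V hx) (hmemV y V hy)
      map_g := fun x y V V' hx hy i => hresId X (𝟙 X) V V' i _ _ _ _ _ _ _ _
      g_mul := fun x y w V hx hy hw => hmul X (𝟙 X) V _ _ _ _ _ _ _ _ _
      g_self := fun x V hx => hone X (𝟙 X) V _ _ _ }
  refine ⟨lineBundle c, c.hasRank_lineBundle, fun i => ?_⟩
  /- §E  THE CHART CLASSES: `[det Ξᵢ^* P] = Ξᵢ^*[c] = [det Lᵢ]` in `Ȟ¹(Xᵢ, 𝒪^×)`, by the coboundary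
    `λ_y(W) := val(i, y; κ(Ξᵢ y), z(Ξᵢ y))` read on the test objects of the opens `W` of `Xᵢ`. -/
  rw [nonempty_iso_iff_detClass_eq (hasRank_pullback (Ξ i) c.hasRank_lineBundle) (hL i)
      (c.isFiniteLocallyFree_lineBundle.pullback (Ξ i)) (F i).isFiniteLocallyFree,
    detClass_pullback (Ξ i) c.isFiniteLocallyFree_lineBundle, c.detClass_lineBundle, CechPic.pullback_mk,
    detClass_eq_mk _ (F i)]
  have hmemW₁ : ∀ (y : Xc i) (W : (Xc i).Opens), W ≤ (F i).U y →
      ∀ w : (W : Scheme.{u}), (W.ι ≫ (Ξ i ≫ 𝟙 X)) w ∈ Ξ i ''ᵁ (F i).U y := by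
    intro y W hW w
    rw [Category.comp_id, Scheme.Hom.comp_apply, Scheme.Opens.ι_apply]
    exact ⟨w.1, hW w.2, rfl⟩
  have hmemW₂ : ∀ (x : X) (W : (Xc i).Opens), W ≤ (Ξ i) ⁻¹ᵁ Ux x →
      ∀ w : (W : Scheme.{u}), (W.ι ≫ (Ξ i ≫ 𝟙 X)) w ∈ Ξ (κ x) ''ᵁ (F (κ x)).U (z x) := by
    intro x W hW w
    rw [Category.comp_id, Scheme.Hom.comp_apply, Scheme.Opens.ι_apply]
    have hw : (Ξ i) w.1 ∈ Ux x := hW w.2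
    rwa [hUx] at hw
  refine CechPic.sound ⟨?_⟩
  exact
    { W := fun y => (Ξ i) ⁻¹ᵁ Ux (Ξ i y) ⊓ (F i).U y
      mem := fun y => ⟨c.mem (Ξ i y), (F i).mem y⟩
      le := fun y => inf_le_left
      le' := fun y => inf_le_right
      lam := fun y W hW => val (Xc i) (Ξ i ≫ 𝟙 X) W i y (κ (Ξ i y)) (z (Ξ i y))
        (hmemW₁ y W (hW.trans inf_le_right)) (hmemW₂ (Ξ i y) W (hW.trans inf_le_left))
      inv := fun y W hW => val (Xc i) (Ξ i ≫ 𝟙 X) W (κ (Ξ i y)) (z (Ξ i y)) i y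
        (hmemW₂ (Ξ i y) W (hW.trans inf_le_left)) (hmemW₁ y W (hW.trans inf_le_right))
      map_lam := fun y W W' hW i' => hresId (Xc i) (Ξ i ≫ 𝟙 X) W W' i' _ _ _ _ _ _ _ _
      lam_mul_inv := fun y W hW => by
        dsimp only
        rw [hmul, hone]
      rel := fun y y' W hy hy' => by
        dsimp only
        -- the frame-system transition function of `L_i` is `val(i,y; i,y')`
        have hFi : (F i).cocycle.g y y' W (hy.trans inf_le_right) (hy'.trans inf_le_right) =
            val (Xc i) (Ξ i ≫ 𝟙 X) W i y i y' (hmemW₁ y W (hy.trans inf_le_right))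
              (hmemW₁ y' W (hy'.trans inf_le_right)) :=
          (hself i W y y' _ _ _ _).symm
        -- the pulled-back transition function of `c` is `val(κ(Ξ y), z(Ξ y); κ(Ξ y'), z(Ξ y'))` (base change along `Ξᵢ`)
        have hc : (UnitCocycle.pullback (Ξ i) c).g y y' W (hy.trans inf_le_left) (hy'.trans inf_le_left) =
            val (Xc i) (Ξ i ≫ 𝟙 X) W (κ (Ξ i y)) (z (Ξ i y)) (κ (Ξ i y')) (z (Ξ i y'))
              (hmemW₂ (Ξ i y) W (hy.trans inf_le_left)) (hmemW₂ (Ξ i y') W (hy'.trans inf_le_left)) :=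
          hres X (Xc i) (Ξ i) (𝟙 X) (Ux (Ξ i y) ⊓ Ux (Ξ i y')) W (UnitCocycle.le_preimage_inf (Ξ i) (hy.trans inf_le_left) (hy'.trans inf_le_left))
            (κ (Ξ i y)) (z (Ξ i y)) (κ (Ξ i y')) (z (Ξ i y')) (hmemV (Ξ i y) _ inf_le_left)
            (hmemV (Ξ i y') _ inf_le_right) (hmemW₂ (Ξ i y) W (hy.trans inf_le_left))
            (hmemW₂ (Ξ i y') W (hy'.trans inf_le_left))
        rw [hFi, hc, hmul, hmul] }

end Literature.AlgebraicGeometry.Modules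

end
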